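import Mathlib

/-!
# `SnSubsetDichotomy.GlobalBranch`, line `bregman-entropy-window` — stub `stub_quotientSpread`

Registered stub `stub_quotientSpread` of crux `stmt-MatrixMultiplication-8303`
(`Summit.MatrixMultiplication.MatrixMultiplication.Theses.SnSubsetDichotomy.GlobalBranch`), line
`bregman-entropy-window`: spreadness of the level-1 marginals passes from a finite set of permutations
`S ⊆ 𝔖ₙ` to the quotient set `S⁻¹T = {s⁻¹t : s ∈ S, t ∈ T}`:
`#{a ∈ S⁻¹T : a i = j} ≤ |T| · max_k #{s ∈ S : s j = k}`.
This is the marginal-convolution bound that lets the entropy Brégman inequality (Cuckler–Kahn) be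
applied to the quotient sets of a TPP triple (Cohn–Umans 2003, around Lemma 3.1).

Proof (pure counting): `a = s⁻¹t` has `a i = s⁻¹ (t i)`, so `a i = j ↔ t i = s j`.  Hence the
elements of `image₂ (fun s t => s⁻¹ * t) S T` with `a i = j` lie in
`⋃_{t ∈ T} (fun s => s⁻¹ * t) '' {s ∈ S : s j = t i}`, and each of the `|T|` pieces has at most
`#{s ∈ S : s j = t i} ≤ m` elements (`Finset.card_biUnion_le_card_mul`, `Finset.card_image_le`).
-/

-- `Summit.<Summit>.<Problem>` is the tree's mandated summit-side namespace; for this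
-- single-conjunct summit the two coincide, so the file silences `dupNamespace`.
set_option linter.dupNamespace false
set_option autoImplicit false

namespace Summit.MatrixMultiplication.MatrixMultiplication.Theorems.GlobalBranch

/-- **Stub `stub_quotientSpread` (spreadness of marginals passes from `S` to the quotient set
`S⁻¹T`).**  For finite sets of permutations `S, T ⊆ 𝔖ₙ`, rows `i, j : Fin n` and a bound `m` on
the column-`j` fibres of `S` (`#{s ∈ S : s j = k} ≤ m` for every `k`), the quotient set
`S⁻¹T = image₂ (fun s t => s⁻¹ * t) S T` satisfies `#{a ∈ S⁻¹T : a i = j} ≤ |T| · m`, i.e.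
`#{a ∈ S⁻¹T : a i = j} ≤ |T| · max_k #{s ∈ S : s j = k}`: the level-1 marginal matrix of the
uniform measure on `S⁻¹T` is spread as soon as that of `S` is.  This is the marginal-convolution
bound behind Cuckler–Kahn-type entropy arguments on the quotient sets of a TPP triple.
Why: `(s⁻¹ * t) i = j ↔ t i = s j`, so grouping the pairs `(s, t)` by `t` the filtered quotient
set is covered by `|T|` images of fibres `{s ∈ S : s j = t i}`, each of size `≤ m`.
[cite: CohnUmans2003, Lemma 3.1] -/
theorem stub_quotientSpread : ∀ (n : ℕ) (S T : Finset (Equiv.Perm (Fin n))) (i j : Fin n) (m : ℕ),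
    (∀ k : Fin n, (S.filter (fun s => s j = k)).card ≤ m) →
      ((Finset.image₂ (fun s t => s⁻¹ * t) S T).filter (fun a => a i = j)).card ≤ T.card * m := by
  intro n S T i j m hm
  -- cover the filtered quotient set by the `T`-indexed images of the column-`j` fibres of `S`
  have hsub : (Finset.image₂ (fun s t => s⁻¹ * t) S T).filter (fun a => a i = j) ⊆
      T.biUnion (fun t => (S.filter (fun s => s j = t i)).image (fun s => s⁻¹ * t)) := by
    intro a ha
    simp only [Finset.mem_filter, Finset.mem_image₂] at ha
    obtain ⟨⟨s, hs, t, ht, rfl⟩, hai⟩ := ha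
    rw [Equiv.Perm.mul_apply, Equiv.Perm.inv_eq_iff_eq] at hai
    simp only [Finset.mem_biUnion, Finset.mem_image, Finset.mem_filter]
    exact ⟨t, ht, s, ⟨hs, hai.symm⟩, rfl⟩
  refine (Finset.card_le_card hsub).trans (Finset.card_biUnion_le_card_mul _ _ _ fun t _ => ?_)
  exact Finset.card_image_le.trans (hm (t i))

end Summit.MatrixMultiplication.MatrixMultiplication.Theorems.GlobalBranch
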